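import Literature.Probability.LatticeModels.ProdBernoulliIndependence
import HarnessLib

/-!
# Gladkov's strong Harris–Kleitman inequality for several events
# (Gladkov 2024, *Bull. Lond. Math. Soc.*, Thm. 2.1)

Topic `Literature/Probability/LatticeModels`; companion of `prodBernoulli` (product of Bernoulli laws
with coordinate-dependent parameters `p : ι → [0,1]` on `Set ι`, `IsoradialPercolation.lean`,
`ProdBernoulliIndependence.lean`).  Everything in this file is PROVED (no definition, no named fact).

## Source, as printed

N. Gladkov, *A strong FKG inequality for multiple events*, Bull. Lond. Math. Soc. 56 (2024)
(doi:10.1112/blms.13101 = arXiv:2305.02653), §2 [Gladkov2024StrongFKG]: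

"We say that measure `μ` on `H_n` [the discrete hypercube] is a product measure if there exist
probability measures `μ_1, …, μ_n` on `{0, 1}`, such that `μ` coincides with the direct product
`μ_1 × ⋯ × μ_n`. Recall the notation `e_2(x_1, …, x_k) := Σ_{1 ≤ i < j ≤ k} x_i x_j` for the second
symmetric polynomial. …
**Theorem 2.1.** Let `μ` be a probability product measure on `H_n`, and
`H_n = A ⊔ C_1 ⊔ C_2 ⊔ ⋯ ⊔ C_k ⊔ B` for `k ≥ 2` such that all sets of the form `A ∪ C_i` are closed
upwards. Then: `μ(A) μ(B) ≥ e_2(μ(C_1), …, μ(C_k))`.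
**Remark 2.2.** [For] `k = 2` we obtain the Harris–Kleitman inequality."

(The paper's Thm. 3.2 extends this to "UI" measures, in particular to all measures with the FKG
lattice condition; only the product-measure case is formalized here.)

## What is proved here (statement shape)

We write the conclusion without the order on the index set as
`(Σ_i μ(C_i))² − Σ_i μ(C_i)² ≤ 2 μ(A) μ(B)`, i.e. `2 e_2 = (Σ c_i)² − Σ c_i²`, and we index the
middle cells by a `Finset s` of an arbitrary type.  The hypothesis `k ≥ 2` is dropped: for
`|s| ≤ 1` the left-hand side vanishes.  `B` is, as printed, the complement of `A ∪ ⋃_i C_i`.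

* `prodBernoulli_strongHarris_of_determinedBy` — Thm. 2.1 for `prodBernoulli p` on `Set ι`
  (`ι` arbitrary) and events determined by a finite set `F` of coordinates ("cylinder events";
  this is exactly the finite-cube statement, the other coordinates being integrated out);
* `prodBernoulli_strongHarris` — the same for a finite index type `ι` (every event is a
  cylinder event), the form used in percolation on finite graphs;
* `prodBernoulli_strongHarris_pairSum` — the conclusion written with the ordered pair sum
  `Σ_{i ≠ j} μ(C_i) μ(C_j) ≤ 2 μ(A) μ(B)`.

## Proof (Gladkov's induction, pp. 2–3 of the paper, mirrored)

Induction on the finite set `F` of coordinates the events depend on (the paper inducts on `n`).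
For `F = ∅` every event is `∅` or `univ` and the claim is trivial.  For `F = insert e F'`, take
the two sections along the coordinate `e`, `X¹ = {ω : insert e ω ∈ X}` and `X⁰ = {ω : ω ∖ {e} ∈ X}`
(events determined by `F'`, to which the induction hypothesis applies — these are the paper's two
"subdivisions", its Fig. 1), and `μ(X) = p_e μ(X¹) + (1 − p_e) μ(X⁰)` (independence of the
coordinate `e` from `F'`).  The paper's cells `A_0, B_0, C_i^+, C_i^∘, C_i^-, D` are, in this
language, the facts `μ(C_i¹) = u_i + v_i`, `μ(C_i⁰) = u_i + t_i`, `μ(A¹) ≥ μ(A⁰) + Σ t_i`,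
`μ(B⁰) ≥ μ(B¹) + Σ v_i` with `u_i = μ(C_i¹ ∩ C_i⁰)`, `v_i = μ(C_i¹ ∩ B⁰)` ("`c_i^-`"),
`t_i = μ(C_i⁰ ∩ A¹)` ("`c_i^+`"), which use exactly that `A ∪ C_i` is closed upwards.  The
conclusion is then the paper's one-variable argument: the defect `f(p) = 2ab − (Σc)² + Σc²` is a
quadratic polynomial in `p = p_e` with `f(0), f(1) ≥ 0` (induction hypotheses) and
`f(p) = p f(1) + (1−p) f(0) + p(1−p) G` with `G ≥ 0` ("the coefficient in `p²` in the LHS is less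
than that of the RHS"), isolated as the arithmetic lemma `StrongHarris.step_arith`.

## References

* N. Gladkov, *A strong FKG inequality for multiple events*, Bull. Lond. Math. Soc. 56 (2024),
  doi:10.1112/blms.13101, arXiv:2305.02653, Thm. 2.1 and its proof (§2). [Gladkov2024StrongFKG]
* T. E. Harris, *A lower bound for the critical probability in a certain percolation process*,
  Proc. Camb. Phil. Soc. 56 (1960) (the case `k = 2`). [Harris1960]
-/

noncomputable section

namespace Literature.Probability.LatticeModels

open MeasureTheory Measure Literature.Probability.Percolation
open scoped ENNReal

variable {ι : Type*}

namespace StrongHarris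

/-! ### The arithmetic of the induction step -/

/-- For nonnegative reals, `Σ v_i² ≤ (Σ v_i)²`. [folklore] -/
theorem sum_sq_le_sq_sum {κ : Type*} (s : Finset κ) (v : κ → ℝ) (hv : ∀ i ∈ s, 0 ≤ v i) :
    ∑ i ∈ s, v i ^ 2 ≤ (∑ i ∈ s, v i) ^ 2 := by
  rw [sq, Finset.sum_mul]
  refine Finset.sum_le_sum fun i hi => ?_
  rw [sq]
  exact mul_le_mul_of_nonneg_left (Finset.single_le_sum hv hi) (hv i hi)

/-- **The induction step of Gladkov's proof, as real arithmetic.**  With `c¹_i = u_i + v_i`,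
`c⁰_i = u_i + t_i` (`v, t ≥ 0`), `a¹ ≥ a⁰ + Σ t`, `b⁰ ≥ b¹ + Σ v`, and the two
induction hypotheses `(Σ c¹)² − Σ (c¹)² ≤ 2 a¹ b¹`, `(Σ c⁰)² − Σ (c⁰)² ≤ 2 a⁰ b⁰`, the convex
combination with weight `p ∈ [0,1]` satisfies `(Σ c)² − Σ c² ≤ 2 a b`: the defect is a concave
quadratic in `p` ("it suffices to prove that the coefficient in `p²` in the LHS is less than that of
the RHS"). [cite: Gladkov2024StrongFKG, proof of Thm. 2.1] -/
theorem step_arith {κ : Type*} (s : Finset κ) {p a₁ a₀ b₁ b₀ : ℝ} {u v t : κ → ℝ}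
    (hp0 : 0 ≤ p) (hp1 : p ≤ 1) (hv : ∀ i ∈ s, 0 ≤ v i) (ht : ∀ i ∈ s, 0 ≤ t i)
    (ha : a₀ + ∑ i ∈ s, t i ≤ a₁) (hb : b₁ + ∑ i ∈ s, v i ≤ b₀)
    (ih₁ : (∑ i ∈ s, (u i + v i)) ^ 2 - ∑ i ∈ s, (u i + v i) ^ 2 ≤ 2 * (a₁ * b₁))
    (ih₀ : (∑ i ∈ s, (u i + t i)) ^ 2 - ∑ i ∈ s, (u i + t i) ^ 2 ≤ 2 * (a₀ * b₀)) :
    (∑ i ∈ s, (p * (u i + v i) + (1 - p) * (u i + t i))) ^ 2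
        - ∑ i ∈ s, (p * (u i + v i) + (1 - p) * (u i + t i)) ^ 2 ≤
      2 * ((p * a₁ + (1 - p) * a₀) * (p * b₁ + (1 - p) * b₀)) := by
  -- atoms
  set C₁ := ∑ i ∈ s, (u i + v i) with hC₁
  set C₀ := ∑ i ∈ s, (u i + t i) with hC₀
  set S₁₁ := ∑ i ∈ s, (u i + v i) ^ 2 with hS₁₁
  set S₀₀ := ∑ i ∈ s, (u i + t i) ^ 2 with hS₀₀
  set S₁₀ := ∑ i ∈ s, (u i + v i) * (u i + t i) with hS₁₀
  set T := ∑ i ∈ s, t i with hT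
  set W := ∑ i ∈ s, v i with hW
  -- the two sums of the convex combination, in terms of the atoms
  have e1 : ∑ i ∈ s, (p * (u i + v i) + (1 - p) * (u i + t i)) = p * C₁ + (1 - p) * C₀ := by
    rw [hC₁, hC₀, Finset.mul_sum, Finset.mul_sum, ← Finset.sum_add_distrib]
  have e2 : ∑ i ∈ s, (p * (u i + v i) + (1 - p) * (u i + t i)) ^ 2 =
      p ^ 2 * S₁₁ + 2 * p * (1 - p) * S₁₀ + (1 - p) ^ 2 * S₀₀ := by
    rw [hS₁₁, hS₁₀, hS₀₀, Finset.mul_sum, Finset.mul_sum, Finset.mul_sum,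
      ← Finset.sum_add_distrib, ← Finset.sum_add_distrib]
    exact Finset.sum_congr rfl fun i _ => by ring
  -- `C₁ - C₀ = W - T` and `S₁₁ - 2 S₁₀ + S₀₀ = Σ (v - t)² ≤ Σ v² + Σ t² ≤ W² + T²`
  have e3 : C₁ - C₀ = W - T := by
    rw [hC₁, hC₀, hW, hT, ← Finset.sum_sub_distrib, ← Finset.sum_sub_distrib]
    exact Finset.sum_congr rfl fun i _ => by ring
  have e4 : S₁₁ - 2 * S₁₀ + S₀₀ = ∑ i ∈ s, (v i - t i) ^ 2 := by
    rw [hS₁₁, hS₁₀, hS₀₀, Finset.mul_sum, ← Finset.sum_sub_distrib, ← Finset.sum_add_distrib]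
    exact Finset.sum_congr rfl fun i _ => by ring
  have h5 : ∑ i ∈ s, (v i - t i) ^ 2 ≤ W ^ 2 + T ^ 2 := by
    calc ∑ i ∈ s, (v i - t i) ^ 2 ≤ ∑ i ∈ s, (v i ^ 2 + t i ^ 2) :=
          Finset.sum_le_sum fun i hi => by nlinarith [hv i hi, ht i hi]
      _ = ∑ i ∈ s, v i ^ 2 + ∑ i ∈ s, t i ^ 2 := Finset.sum_add_distrib
      _ ≤ W ^ 2 + T ^ 2 := add_le_add (sum_sq_le_sq_sum s v hv) (sum_sq_le_sq_sum s t ht)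
  have hT0 : 0 ≤ T := Finset.sum_nonneg ht
  have hW0 : 0 ≤ W := Finset.sum_nonneg hv
  -- the quadratic defect and its decomposition `f p = p f 1 + (1-p) f 0 + p (1-p) G`
  set G := -2 * ((a₁ - a₀) * (b₁ - b₀)) + (C₁ - C₀) ^ 2 - (S₁₁ - 2 * S₁₀ + S₀₀) with hG
  have hG0 : 0 ≤ G := by
    have h6 : 2 * (T * W) ≤ -2 * ((a₁ - a₀) * (b₁ - b₀)) := by nlinarith
    rw [hG, e3, e4]
    nlinarith [h5, h6]
  have key : 2 * ((p * a₁ + (1 - p) * a₀) * (p * b₁ + (1 - p) * b₀)) -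
      ((p * C₁ + (1 - p) * C₀) ^ 2 - (p ^ 2 * S₁₁ + 2 * p * (1 - p) * S₁₀ + (1 - p) ^ 2 * S₀₀)) =
      p * (2 * (a₁ * b₁) - (C₁ ^ 2 - S₁₁)) + (1 - p) * (2 * (a₀ * b₀) - (C₀ ^ 2 - S₀₀)) +
        p * (1 - p) * G := by
    rw [hG]; ring
  rw [e1, e2]
  have h7 : 0 ≤ p * (2 * (a₁ * b₁) - (C₁ ^ 2 - S₁₁)) := mul_nonneg hp0 (by linarith)
  have h8 : 0 ≤ (1 - p) * (2 * (a₀ * b₀) - (C₀ ^ 2 - S₀₀)) := mul_nonneg (by linarith) (by linarith)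
  have h9 : 0 ≤ p * (1 - p) * G := mul_nonneg (mul_nonneg hp0 (by linarith)) hG0
  linarith [key, h7, h8, h9]

/-! ### Sections of an event along one coordinate

For an event `X ⊆ Set ι` and a coordinate `e`, the two sections are the preimages
`insert e ⁻¹' X = {ω : insert e ω ∈ X}` ("`X¹`") and `(· \ {e}) ⁻¹' X = {ω : ω ∖ {e} ∈ X}` ("`X⁰`")
(the paper's restrictions to the vectors with last coordinate `1`, resp. `0`). -/

section Sections

variable {e : ι}

/-- Sections of an upper set are upper sets (`insert e` is monotone). [folklore] -/
theorem isUpperSet_preimage_insert {X : Set (Set ι)} (hX : IsUpperSet X) :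
    IsUpperSet (insert e ⁻¹' X) :=
  hX.preimage fun _ _ h => Set.insert_subset_insert h

/-- Sections of an upper set are upper sets (`· ∖ {e}` is monotone). [folklore] -/
theorem isUpperSet_preimage_sdiff {X : Set (Set ι)} (hX : IsUpperSet X) :
    IsUpperSet ((· \ {e}) ⁻¹' X) :=
  hX.preimage fun _ _ h => Set.sdiff_subset_sdiff_left h

/-- An event determined by `insert e F'` has upper section determined by `F'`. [folklore] -/
theorem determinedBy_preimage_insert {X : Set (Set ι)} {F' : Finset ι} [DecidableEq ι]
    (hX : DeterminedBy X (↑(insert e F') : Set ι)) :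
    DeterminedBy (insert e ⁻¹' X) (↑F' : Set ι) := by
  rw [determinedBy_iff] at hX ⊢
  intro ω ω' h
  simp only [Set.mem_preimage]
  refine hX _ _ ?_
  ext x
  simp only [Finset.coe_insert, Set.mem_inter_iff, Set.mem_insert_iff]
  have hx := Set.ext_iff.1 h x
  simp only [Set.mem_inter_iff, Finset.mem_coe] at hx
  constructor
  · rintro ⟨h1 | h1, h2 | h2⟩
    · exact ⟨Or.inl h1, Or.inl h2⟩
    · exact ⟨Or.inl h1, Or.inr h2⟩
    · subst h2; exact ⟨Or.inl rfl, Or.inl rfl⟩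
    · exact ⟨Or.inr (hx.1 ⟨h1, h2⟩).1, Or.inr h2⟩
  · rintro ⟨h1 | h1, h2 | h2⟩
    · exact ⟨Or.inl h1, Or.inl h2⟩
    · exact ⟨Or.inl h1, Or.inr h2⟩
    · subst h2; exact ⟨Or.inl rfl, Or.inl rfl⟩
    · exact ⟨Or.inr (hx.2 ⟨h1, h2⟩).1, Or.inr h2⟩

/-- An event determined by `insert e F'` has lower section determined by `F'`. [folklore] -/
theorem determinedBy_preimage_sdiff {X : Set (Set ι)} {F' : Finset ι} [DecidableEq ι]
    (hX : DeterminedBy X (↑(insert e F') : Set ι)) :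
    DeterminedBy ((· \ {e}) ⁻¹' X) (↑F' : Set ι) := by
  rw [determinedBy_iff] at hX ⊢
  intro ω ω' h
  simp only [Set.mem_preimage]
  refine hX _ _ ?_
  ext x
  simp only [Finset.coe_insert, Set.mem_inter_iff, Set.mem_sdiff, Set.mem_singleton_iff,
    Set.mem_insert_iff]
  have hx := Set.ext_iff.1 h x
  simp only [Set.mem_inter_iff, Finset.mem_coe] at hx
  constructor
  · rintro ⟨⟨h1, h2⟩, h3 | h3⟩
    · exact absurd h3 h2
    · exact ⟨⟨(hx.1 ⟨h1, h3⟩).1, h2⟩, Or.inr h3⟩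
  · rintro ⟨⟨h1, h2⟩, h3 | h3⟩
    · exact absurd h3 h2
    · exact ⟨⟨(hx.2 ⟨h1, h3⟩).1, h2⟩, Or.inr h3⟩

/-- The upper section of any event is determined by the coordinates other than `e`. [folklore] -/
theorem determinedBy_preimage_insert_compl (X : Set (Set ι)) :
    DeterminedBy (insert e ⁻¹' X) (↑({e} : Finset ι) : Set ι)ᶜ := by
  rw [determinedBy_iff]
  intro ω ω' h
  simp only [Set.mem_preimage]
  have : insert e ω = insert e ω' := by
    ext x
    simp only [Set.mem_insert_iff]
    by_cases hx : x = e
    · simp [hx]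
    · have hx' := Set.ext_iff.1 h x
      simp only [Set.mem_inter_iff, Set.mem_compl_iff, Finset.coe_singleton,
        Set.mem_singleton_iff, hx, not_false_eq_true, and_true] at hx'
      simp [hx, hx']
  rw [this]

/-- The lower section of any event is determined by the coordinates other than `e`. [folklore] -/
theorem determinedBy_preimage_sdiff_compl (X : Set (Set ι)) :
    DeterminedBy ((· \ {e}) ⁻¹' X) (↑({e} : Finset ι) : Set ι)ᶜ := by
  rw [determinedBy_iff]
  intro ω ω' h
  simp only [Set.mem_preimage]
  have : ω \ {e} = ω' \ {e} := by
    ext x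
    simp only [Set.mem_sdiff, Set.mem_singleton_iff]
    by_cases hx : x = e
    · simp [hx]
    · have hx' := Set.ext_iff.1 h x
      simp only [Set.mem_inter_iff, Set.mem_compl_iff, Finset.coe_singleton,
        Set.mem_singleton_iff, hx, not_false_eq_true, and_true] at hx'
      simp [hx, hx']
  rw [this]

/-- The coordinate event `{e ∈ ω}` is determined by `{e}`. [folklore] -/
theorem determinedBy_mem_singleton :
    DeterminedBy {ω : Set ι | e ∈ ω} (↑({e} : Finset ι) : Set ι) := by
  rw [determinedBy_iff]
  intro ω ω' h
  have hx := Set.ext_iff.1 h e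
  simp only [Set.mem_inter_iff, Finset.coe_singleton, Set.mem_singleton_iff, and_true] at hx
  exact hx

/-- The coordinate event `{e ∉ ω}` is determined by `{e}`. [folklore] -/
theorem determinedBy_notMem_singleton :
    DeterminedBy {ω : Set ι | e ∉ ω} (↑({e} : Finset ι) : Set ι) := by
  rw [determinedBy_iff]
  intro ω ω' h
  have hx := Set.ext_iff.1 h e
  simp only [Set.mem_inter_iff, Finset.coe_singleton, Set.mem_singleton_iff, and_true] at hx
  simp only [Set.mem_setOf_eq, hx]

/-- **One-coordinate decomposition**: `μ(X) = p_e μ(X¹) + (1 − p_e) μ(X⁰)` for a cylinder event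
`X` (independence of the coordinate `e` from the others).
[cite: Gladkov2024StrongFKG, proof of Thm. 2.1 ("the projection of product measure … is also a product measure")] -/
theorem real_eq_preimage_insert_add_preimage_sdiff (p : ι → unitInterval) (e : ι) {X : Set (Set ι)}
    {F : Finset ι} (hX : DeterminedBy X (↑F : Set ι)) :
    (prodBernoulli p).real X =
      p e * (prodBernoulli p).real (insert e ⁻¹' X) +
        (1 - p e) * (prodBernoulli p).real ((· \ {e}) ⁻¹' X) := by
  classical
  set μ := prodBernoulli p with hμ
  -- the sections are cylinder events over `F`, hence measurable
  have hX' : DeterminedBy X (↑(insert e F) : Set ι) :=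
    hX.mono (by simp [Finset.coe_insert, Set.subset_insert])
  have hUm : MeasurableSet (insert e ⁻¹' X) :=
    (determinedBy_preimage_insert hX').measurableSet_of_finset
  have hDm : MeasurableSet ((· \ {e}) ⁻¹' X) :=
    (determinedBy_preimage_sdiff hX').measurableSet_of_finset
  -- split `X` along `{e ∈ ω}`
  have hsplit := measureReal_inter_add_sdiff (μ := μ) (s := X) (measurableSet_mem e)
    (measure_ne_top _ _)
  have h1 : X ∩ {ω : Set ι | e ∈ ω} = {ω : Set ι | e ∈ ω} ∩ insert e ⁻¹' X := by
    ext ω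
    simp only [Set.mem_inter_iff, Set.mem_setOf_eq, Set.mem_preimage]
    constructor
    · rintro ⟨hω, he⟩; exact ⟨he, by rwa [Set.insert_eq_of_mem he]⟩
    · rintro ⟨he, hω⟩; exact ⟨by rwa [Set.insert_eq_of_mem he] at hω, he⟩
  have h2 : X \ {ω : Set ι | e ∈ ω} = {ω : Set ι | e ∉ ω} ∩ (· \ {e}) ⁻¹' X := by
    ext ω
    simp only [Set.mem_sdiff, Set.mem_setOf_eq, Set.mem_inter_iff, Set.mem_preimage]
    constructor
    · rintro ⟨hω, he⟩
      exact ⟨he, by rwa [Set.sdiff_singleton_eq_self he]⟩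
    · rintro ⟨he, hω⟩
      exact ⟨by rwa [Set.sdiff_singleton_eq_self he] at hω, he⟩
  have i1 : μ.real ({ω : Set ι | e ∈ ω} ∩ insert e ⁻¹' X) = p e * μ.real (insert e ⁻¹' X) := by
    rw [hμ, prodBernoulli_real_inter_of_determinedBy p {e} determinedBy_mem_singleton
      (determinedBy_preimage_insert_compl X) (measurableSet_mem e) hUm,
      prodBernoulli_real_setOf_mem]
  have i2 : μ.real ({ω : Set ι | e ∉ ω} ∩ (· \ {e}) ⁻¹' X) =
      (1 - p e) * μ.real ((· \ {e}) ⁻¹' X) := by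
    rw [hμ, prodBernoulli_real_inter_of_determinedBy p {e} determinedBy_notMem_singleton
      (determinedBy_preimage_sdiff_compl X) (measurableSet_notMem e) hDm,
      prodBernoulli_real_setOf_notMem]
  rw [← hsplit, h1, h2, i1, i2]

end Sections

/-! ### The cells of Theorem 2.1: elementary consequences of the hypotheses -/

section Cells

variable {κ : Type*} {s : Finset κ} {A B : Set (Set ι)} {C : κ → Set (Set ι)}

/-- `B = (A ∪ ⋃ C i)ᶜ` is closed downwards when `A` and all `A ∪ C i` are closed upwards.
[folklore] -/
theorem isLowerSet_bottom (hup : ∀ i ∈ s, IsUpperSet (A ∪ C i)) (hA : IsUpperSet A)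
    (hB : ∀ ω, ω ∈ B ↔ ω ∉ A ∧ ∀ i ∈ s, ω ∉ C i) : IsLowerSet B := by
  intro ω ω' hle hω
  rw [hB] at hω ⊢
  refine ⟨fun h => hω.1 (hA hle h), fun i hi hC => ?_⟩
  rcases hup i hi hle (Or.inr hC) with h | h
  · exact hω.1 h
  · exact hω.2 i hi h

/-- Below a configuration of a middle cell `C i` there are only configurations of `C i` or of
`B`. [cite: Gladkov2024StrongFKG, proof of Thm. 2.1 (the cells `C_i^∘`, `C_i^-`)] -/
theorem bottom_or_same_of_le (hdisj : ∀ i ∈ s, ∀ j ∈ s, i ≠ j → Disjoint (C i) (C j))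
    (hdisjA : ∀ i ∈ s, Disjoint A (C i)) (hup : ∀ i ∈ s, IsUpperSet (A ∪ C i))
    (hA : IsUpperSet A) (hB : ∀ ω, ω ∈ B ↔ ω ∉ A ∧ ∀ i ∈ s, ω ∉ C i) {i : κ} (hi : i ∈ s)
    {ω ω' : Set ι} (hle : ω ≤ ω') (hω' : ω' ∈ C i) : ω ∈ B ∨ ω ∈ C i := by
  by_cases hCi : ω ∈ C i
  · exact Or.inr hCi
  refine Or.inl ((hB ω).2 ⟨fun h => ?_, fun j hj hCj => ?_⟩)
  · exact Set.disjoint_left.1 (hdisjA i hi) (hA hle h) hω'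
  · rcases hup j hj hle (Or.inr hCj) with hA' | hC'
    · exact Set.disjoint_left.1 (hdisjA i hi) hA' hω'
    · by_cases hij : j = i
      · subst hij; exact hCi hCj
      · exact Set.disjoint_left.1 (hdisj j hj i hi hij) hC' hω'

/-- `B` is determined by `F` when `A` and the `C i` are. [folklore] -/
theorem determinedBy_bottom {F : Set ι} (hB : ∀ ω, ω ∈ B ↔ ω ∉ A ∧ ∀ i ∈ s, ω ∉ C i)
    (hAF : DeterminedBy A F) (hCF : ∀ i ∈ s, DeterminedBy (C i) F) : DeterminedBy B F := by
  rw [determinedBy_iff] at hAF ⊢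
  intro ω ω' hω
  rw [hB, hB, hAF ω ω' hω]
  refine and_congr_right fun _ => forall₂_congr fun i hi => ?_
  rw [(determinedBy_iff _ _).1 (hCF i hi) ω ω' hω]

end Cells

/-! ### The induction on the set of coordinates -/

/-- **The core statement `P(F)`**, proved by induction on the finite set `F` of coordinates:
Thm. 2.1 for all systems `(A, (C i)_{i ∈ s}, B)` of cylinder events over `F` with the `C i`
pairwise disjoint and disjoint from `A`, all `A ∪ C i` and `A` closed upwards, and `B` the
complement of `A ∪ ⋃ C i`. [cite: Gladkov2024StrongFKG, Thm. 2.1 and its proof] -/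
theorem core [DecidableEq ι] (p : ι → unitInterval) {κ : Type*} (s : Finset κ) (F : Finset ι) :
    ∀ (A B : Set (Set ι)) (C : κ → Set (Set ι)),
      (∀ i ∈ s, ∀ j ∈ s, i ≠ j → Disjoint (C i) (C j)) → (∀ i ∈ s, Disjoint A (C i)) →
      (∀ i ∈ s, IsUpperSet (A ∪ C i)) → IsUpperSet A →
      (∀ ω, ω ∈ B ↔ ω ∉ A ∧ ∀ i ∈ s, ω ∉ C i) →
      DeterminedBy A (↑F : Set ι) → (∀ i ∈ s, DeterminedBy (C i) (↑F : Set ι)) →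
      (∑ i ∈ s, (prodBernoulli p).real (C i)) ^ 2 - ∑ i ∈ s, (prodBernoulli p).real (C i) ^ 2 ≤
        2 * ((prodBernoulli p).real A * (prodBernoulli p).real B) := by
  set μ := prodBernoulli p with hμ
  induction F using Finset.induction_on with
  | empty =>
    intro A B C hdisj hdisjA hup hupA hB hA hC
    -- every event is `∅` or `univ`; the `C i` are disjoint, so `Σ μ(C i) ≤ 1` and each is `0` or `1`
    have triv : ∀ X : Set (Set ι), DeterminedBy X (↑(∅ : Finset ι) : Set ι) →
        X = ∅ ∨ X = Set.univ := by
      intro X hX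
      rw [determinedBy_iff] at hX
      by_cases hne : X.Nonempty
      · obtain ⟨ω₀, hω₀⟩ := hne
        exact Or.inr (Set.eq_univ_of_forall fun ω => (hX ω ω₀ (by simp)).2 hω₀)
      · exact Or.inl (Set.not_nonempty_iff_eq_empty.1 hne)
    have hc01 : ∀ i ∈ s, μ.real (C i) = 0 ∨ μ.real (C i) = 1 := by
      intro i hi
      rcases triv (C i) (hC i hi) with h | h
      · exact Or.inl (by rw [h, measureReal_empty])
      · exact Or.inr (by rw [h, probReal_univ])
    have hsq : ∑ i ∈ s, μ.real (C i) ^ 2 = ∑ i ∈ s, μ.real (C i) :=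
      Finset.sum_congr rfl fun i hi => by rcases hc01 i hi with h | h <;> simp [h]
    have hle1 : ∑ i ∈ s, μ.real (C i) ≤ 1 := by
      rw [← measureReal_biUnion_finset (μ := μ)
        (fun i hi j hj hij => hdisj i (Finset.mem_coe.1 hi) j (Finset.mem_coe.1 hj) hij)
        (fun i hi => (hC i hi).measurableSet_of_finset) (fun i _ => measure_ne_top _ _)]
      exact (measureReal_mono (Set.subset_univ _) (measure_ne_top _ _)).trans_eq probReal_univ
    have h0 : 0 ≤ ∑ i ∈ s, μ.real (C i) := Finset.sum_nonneg fun i _ => measureReal_nonneg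
    rw [hsq]
    have hAB : 0 ≤ 2 * (μ.real A * μ.real B) := by positivity
    nlinarith [hle1, h0, hAB]
  | insert e F' he ih =>
    intro A B C hdisj hdisjA hup hupA hB hA hC
    -- notation for the sections
    set A₁ := insert e ⁻¹' A with hA₁d
    set A₀ := (· \ {e}) ⁻¹' A with hA₀d
    set B₁ := insert e ⁻¹' B with hB₁d
    set B₀ := (· \ {e}) ⁻¹' B with hB₀d
    set C₁ : κ → Set (Set ι) := fun i => insert e ⁻¹' C i with hC₁d
    set C₀ : κ → Set (Set ι) := fun i => (· \ {e}) ⁻¹' C i with hC₀d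
    have hle : ∀ ω : Set ι, ω \ {e} ≤ insert e ω := fun ω =>
      (Set.sdiff_subset).trans (Set.subset_insert e ω)
    -- the sections are again systems of cylinder events, now over `F'`
    have hBdet : DeterminedBy B (↑(insert e F') : Set ι) := determinedBy_bottom hB hA hC
    have hA₁ : DeterminedBy A₁ (↑F' : Set ι) := determinedBy_preimage_insert hA
    have hA₀ : DeterminedBy A₀ (↑F' : Set ι) := determinedBy_preimage_sdiff hA
    have hB₁ : DeterminedBy B₁ (↑F' : Set ι) := determinedBy_preimage_insert hBdet
    have hB₀ : DeterminedBy B₀ (↑F' : Set ι) := determinedBy_preimage_sdiff hBdet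
    have hC₁ : ∀ i ∈ s, DeterminedBy (C₁ i) (↑F' : Set ι) := fun i hi =>
      determinedBy_preimage_insert (hC i hi)
    have hC₀ : ∀ i ∈ s, DeterminedBy (C₀ i) (↑F' : Set ι) := fun i hi =>
      determinedBy_preimage_sdiff (hC i hi)
    have ih₁ := ih A₁ B₁ C₁ (fun i hi j hj hij => (hdisj i hi j hj hij).preimage _)
      (fun i hi => (hdisjA i hi).preimage _)
      (fun i hi => isUpperSet_preimage_insert (hup i hi)) (isUpperSet_preimage_insert hupA)
      (fun ω => by simpa [hB₁d, hA₁d, hC₁d] using hB (insert e ω)) hA₁ hC₁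
    have ih₀ := ih A₀ B₀ C₀ (fun i hi j hj hij => (hdisj i hi j hj hij).preimage _)
      (fun i hi => (hdisjA i hi).preimage _)
      (fun i hi => isUpperSet_preimage_sdiff (hup i hi)) (isUpperSet_preimage_sdiff hupA)
      (fun ω => by simpa [hB₀d, hA₀d, hC₀d] using hB (ω \ {e})) hA₀ hC₀
    -- measurability of everything in sight (cylinder events over `F'`)
    have mA₁ : MeasurableSet A₁ := hA₁.measurableSet_of_finset
    have mB₀ : MeasurableSet B₀ := hB₀.measurableSet_of_finset
    have mC₁ : ∀ i ∈ s, MeasurableSet (C₁ i) := fun i hi => (hC₁ i hi).measurableSet_of_finset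
    have mC₀ : ∀ i ∈ s, MeasurableSet (C₀ i) := fun i hi => (hC₀ i hi).measurableSet_of_finset
    -- the pieces `u_i = μ(C¹ ∩ C⁰)`, `v_i = μ(C¹ ∩ B⁰)` (`c_i^-`), `t_i = μ(C⁰ ∩ A¹)` (`c_i^+`)
    set u : κ → ℝ := fun i => μ.real (C₁ i ∩ C₀ i) with hu
    set v : κ → ℝ := fun i => μ.real (C₁ i ∩ B₀) with hv
    set t : κ → ℝ := fun i => μ.real (C₀ i ∩ A₁) with ht
    have hBC : ∀ i ∈ s, Disjoint B (C i) := fun i hi =>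
      Set.disjoint_left.2 fun ω hω hCω => ((hB ω).1 hω).2 i hi hCω
    -- `μ(C_i¹) = u_i + v_i`
    have hc₁ : ∀ i ∈ s, μ.real (C₁ i) = u i + v i := by
      intro i hi
      have hset : C₁ i = (C₁ i ∩ C₀ i) ∪ (C₁ i ∩ B₀) := by
        ext ω
        simp only [Set.mem_union, Set.mem_inter_iff, hC₁d, hC₀d, hB₀d, Set.mem_preimage]
        constructor
        · intro hω
          rcases bottom_or_same_of_le hdisj hdisjA hup hupA hB hi (hle ω) hω with hB' | hC'
          · exact Or.inr ⟨hω, hB'⟩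
          · exact Or.inl ⟨hω, hC'⟩
        · rintro (⟨h1, -⟩ | ⟨h1, -⟩) <;> exact h1
      have hd : Disjoint (C₁ i ∩ C₀ i) (C₁ i ∩ B₀) :=
        Set.disjoint_left.2 fun ω h1 h2 => Set.disjoint_left.1 (hBC i hi) h2.2 h1.2
      rw [hu, hv]
      simp only
      rw [← measureReal_union hd ((mC₁ i hi).inter mB₀) (measure_ne_top _ _) (measure_ne_top _ _),
        ← hset]
    -- `μ(C_i⁰) = u_i + t_i`
    have hc₀ : ∀ i ∈ s, μ.real (C₀ i) = u i + t i := by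
      intro i hi
      have hset : C₀ i = (C₁ i ∩ C₀ i) ∪ (C₀ i ∩ A₁) := by
        ext ω
        simp only [Set.mem_union, Set.mem_inter_iff, hC₁d, hC₀d, hA₁d, Set.mem_preimage]
        constructor
        · intro hω
          rcases hup i hi (hle ω) (Or.inr hω) with hA' | hC'
          · exact Or.inr ⟨hω, hA'⟩
          · exact Or.inl ⟨hC', hω⟩
        · rintro (⟨-, h1⟩ | ⟨h1, -⟩) <;> exact h1
      have hd : Disjoint (C₁ i ∩ C₀ i) (C₀ i ∩ A₁) :=
        Set.disjoint_left.2 fun ω h1 h2 => Set.disjoint_left.1 (hdisjA i hi) h2.2 h1.1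
      rw [hu, ht]
      simp only
      rw [← measureReal_union hd ((mC₀ i hi).inter mA₁) (measure_ne_top _ _) (measure_ne_top _ _),
        ← hset]
    -- `μ(A¹) ≥ μ(A⁰) + Σ t_i`
    have ha : μ.real A₀ + ∑ i ∈ s, t i ≤ μ.real A₁ := by
      have hsub : A₀ ∪ ⋃ i ∈ s, (C₀ i ∩ A₁) ⊆ A₁ :=
        Set.union_subset (fun ω hω => hupA (hle ω) hω)
          (Set.iUnion₂_subset fun i _ => Set.inter_subset_right)
      have hpd : (↑s : Set κ).PairwiseDisjoint fun i => C₀ i ∩ A₁ :=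
        fun i hi j hj hij => Set.disjoint_left.2 fun ω h1 h2 =>
          Set.disjoint_left.1 (hdisj i (Finset.mem_coe.1 hi) j (Finset.mem_coe.1 hj) hij) h1.1 h2.1
      have hd0 : Disjoint A₀ (⋃ i ∈ s, (C₀ i ∩ A₁)) := by
        refine Set.disjoint_left.2 fun ω h1 h2 => ?_
        simp only [Set.mem_iUnion, Set.mem_inter_iff, exists_prop] at h2
        obtain ⟨i, hi, h3, -⟩ := h2
        exact Set.disjoint_left.1 (hdisjA i hi) h1 h3
      have hmU : MeasurableSet (⋃ i ∈ s, (C₀ i ∩ A₁)) :=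
        Finset.measurableSet_biUnion s fun i hi => (mC₀ i hi).inter mA₁
      calc μ.real A₀ + ∑ i ∈ s, t i
          = μ.real (A₀ ∪ ⋃ i ∈ s, (C₀ i ∩ A₁)) := by
            rw [measureReal_union hd0 hmU (measure_ne_top _ _) (measure_ne_top _ _),
              measureReal_biUnion_finset hpd (fun i hi => (mC₀ i hi).inter mA₁)
              (fun i _ => measure_ne_top _ _)]
        _ ≤ μ.real A₁ := measureReal_mono hsub (measure_ne_top _ _)
    -- `μ(B⁰) ≥ μ(B¹) + Σ v_i`
    have hb : μ.real B₁ + ∑ i ∈ s, v i ≤ μ.real B₀ := by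
      have hlow : IsLowerSet B := isLowerSet_bottom hup hupA hB
      have hsub : B₁ ∪ ⋃ i ∈ s, (C₁ i ∩ B₀) ⊆ B₀ :=
        Set.union_subset (fun ω hω => hlow (hle ω) hω)
          (Set.iUnion₂_subset fun i _ => Set.inter_subset_right)
      have hpd : (↑s : Set κ).PairwiseDisjoint fun i => C₁ i ∩ B₀ :=
        fun i hi j hj hij => Set.disjoint_left.2 fun ω h1 h2 =>
          Set.disjoint_left.1 (hdisj i (Finset.mem_coe.1 hi) j (Finset.mem_coe.1 hj) hij) h1.1 h2.1
      have hd0 : Disjoint B₁ (⋃ i ∈ s, (C₁ i ∩ B₀)) := by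
        refine Set.disjoint_left.2 fun ω h1 h2 => ?_
        simp only [Set.mem_iUnion, Set.mem_inter_iff, exists_prop] at h2
        obtain ⟨i, hi, h3, -⟩ := h2
        exact Set.disjoint_left.1 (hBC i hi) h1 h3
      have hmU : MeasurableSet (⋃ i ∈ s, (C₁ i ∩ B₀)) :=
        Finset.measurableSet_biUnion s fun i hi => (mC₁ i hi).inter mB₀
      calc μ.real B₁ + ∑ i ∈ s, v i
          = μ.real (B₁ ∪ ⋃ i ∈ s, (C₁ i ∩ B₀)) := by
            rw [measureReal_union hd0 hmU (measure_ne_top _ _) (measure_ne_top _ _),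
              measureReal_biUnion_finset hpd (fun i hi => (mC₁ i hi).inter mB₀)
              (fun i _ => measure_ne_top _ _)]
        _ ≤ μ.real B₀ := measureReal_mono hsub (measure_ne_top _ _)
    -- one-coordinate decompositions
    have dA := real_eq_preimage_insert_add_preimage_sdiff p e hA
    have dB := real_eq_preimage_insert_add_preimage_sdiff p e hBdet
    have dC : ∀ i ∈ s, μ.real (C i) = p e * (u i + v i) + (1 - p e) * (u i + t i) := by
      intro i hi
      rw [hμ, real_eq_preimage_insert_add_preimage_sdiff p e (hC i hi), ← hμ, ← hc₁ i hi, ← hc₀ i hi]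
    -- rewrite everything and apply the arithmetic step
    have eS : ∑ i ∈ s, μ.real (C i) = ∑ i ∈ s, (p e * (u i + v i) + (1 - p e) * (u i + t i)) :=
      Finset.sum_congr rfl dC
    have eS2 : ∑ i ∈ s, μ.real (C i) ^ 2 =
        ∑ i ∈ s, (p e * (u i + v i) + (1 - p e) * (u i + t i)) ^ 2 :=
      Finset.sum_congr rfl fun i hi => by rw [dC i hi]
    have ih₁' : (∑ i ∈ s, (u i + v i)) ^ 2 - ∑ i ∈ s, (u i + v i) ^ 2 ≤
        2 * (μ.real A₁ * μ.real B₁) := by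
      have e1 : ∑ i ∈ s, μ.real (C₁ i) = ∑ i ∈ s, (u i + v i) := Finset.sum_congr rfl hc₁
      have e2 : ∑ i ∈ s, μ.real (C₁ i) ^ 2 = ∑ i ∈ s, (u i + v i) ^ 2 :=
        Finset.sum_congr rfl fun i hi => by rw [hc₁ i hi]
      rw [← e1, ← e2]; exact ih₁
    have ih₀' : (∑ i ∈ s, (u i + t i)) ^ 2 - ∑ i ∈ s, (u i + t i) ^ 2 ≤
        2 * (μ.real A₀ * μ.real B₀) := by
      have e1 : ∑ i ∈ s, μ.real (C₀ i) = ∑ i ∈ s, (u i + t i) := Finset.sum_congr rfl hc₀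
      have e2 : ∑ i ∈ s, μ.real (C₀ i) ^ 2 = ∑ i ∈ s, (u i + t i) ^ 2 :=
        Finset.sum_congr rfl fun i hi => by rw [hc₀ i hi]
      rw [← e1, ← e2]; exact ih₀
    rw [eS, eS2, hμ, dA, dB, ← hμ]
    exact step_arith s (p e).2.1 (p e).2.2 (fun i _ => measureReal_nonneg)
      (fun i _ => measureReal_nonneg) ha hb ih₁' ih₀'

end StrongHarris

open StrongHarris

/-- **Gladkov's strong Harris–Kleitman inequality (cylinder-event form).**  Let `μ = prodBernoulli p`
on `Set ι`, let the events `A` and `C i` (`i ∈ s`) be determined by a finite set `F` of coordinates,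
the `C i` pairwise disjoint and disjoint from `A`, and every `A ∪ C i` closed upwards (for `|s| ≥ 2`
this makes `A` closed upwards; in general we assume it).  Then, with `B := (A ∪ ⋃_{i ∈ s} C i)ᶜ`,
`(Σ_{i∈s} μ(C i))² − Σ_{i∈s} μ(C i)² ≤ 2 μ(A) μ(B)`, i.e. `μ(A) μ(B) ≥ e_2(μ(C_i))`.
[cite: Gladkov2024StrongFKG, Thm. 2.1] -/
theorem prodBernoulli_strongHarris_of_determinedBy (p : ι → unitInterval) {κ : Type*} (s : Finset κ)
    (F : Finset ι) {A : Set (Set ι)} {C : κ → Set (Set ι)}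
    (hdisj : ∀ i ∈ s, ∀ j ∈ s, i ≠ j → Disjoint (C i) (C j))
    (hdisjA : ∀ i ∈ s, Disjoint A (C i)) (hup : ∀ i ∈ s, IsUpperSet (A ∪ C i)) (hA : IsUpperSet A)
    (hAF : DeterminedBy A (↑F : Set ι)) (hCF : ∀ i ∈ s, DeterminedBy (C i) (↑F : Set ι)) :
    (∑ i ∈ s, (prodBernoulli p).real (C i)) ^ 2 - ∑ i ∈ s, (prodBernoulli p).real (C i) ^ 2 ≤
      2 * ((prodBernoulli p).real A * (prodBernoulli p).real (A ∪ ⋃ i ∈ s, C i)ᶜ) := by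
  classical
  refine core p s F A _ C hdisj hdisjA hup hA (fun ω => ?_) hAF hCF
  simp only [Set.mem_compl_iff, Set.mem_union, Set.mem_iUnion, exists_prop, not_or, not_exists,
    not_and]

/-- **Gladkov's strong Harris–Kleitman inequality, finite index type.**  For `μ = prodBernoulli p`
on `Set ι` with `ι` finite, cells `C i` (`i ∈ s`) pairwise disjoint and disjoint from the up-set `A`
with every `A ∪ C i` closed upwards, and `B := (A ∪ ⋃ C i)ᶜ`:
`(Σ μ(C i))² − Σ μ(C i)² ≤ 2 μ(A) μ(B)` ("`μ(A) μ(B) ≥ e_2(μ(C_1), …, μ(C_k))`"; `k = 2` is the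
Harris–Kleitman inequality). [cite: Gladkov2024StrongFKG, Thm. 2.1] -/
theorem prodBernoulli_strongHarris [Finite ι] (p : ι → unitInterval) {κ : Type*} (s : Finset κ)
    {A : Set (Set ι)} {C : κ → Set (Set ι)}
    (hdisj : ∀ i ∈ s, ∀ j ∈ s, i ≠ j → Disjoint (C i) (C j))
    (hdisjA : ∀ i ∈ s, Disjoint A (C i)) (hup : ∀ i ∈ s, IsUpperSet (A ∪ C i)) (hA : IsUpperSet A) :
    (∑ i ∈ s, (prodBernoulli p).real (C i)) ^ 2 - ∑ i ∈ s, (prodBernoulli p).real (C i) ^ 2 ≤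
      2 * ((prodBernoulli p).real A * (prodBernoulli p).real (A ∪ ⋃ i ∈ s, C i)ᶜ) := by
  classical
  haveI := Fintype.ofFinite ι
  have hall : ∀ X : Set (Set ι), DeterminedBy X (↑(Finset.univ : Finset ι) : Set ι) := fun X => by
    rw [determinedBy_iff]; intro ω ω' h; simp only [Finset.coe_univ, Set.inter_univ] at h; rw [h]
  exact prodBernoulli_strongHarris_of_determinedBy p s Finset.univ hdisj hdisjA hup hA (hall A)
    fun i _ => hall (C i)

/-- The conclusion of Thm. 2.1 with the ordered pair sum: `Σ_{i ∈ s} Σ_{j ∈ s, j ≠ i} μ(C i) μ(C j)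
≤ 2 μ(A) μ(B)` (twice `e_2`). [cite: Gladkov2024StrongFKG, Thm. 2.1] -/
theorem prodBernoulli_strongHarris_pairSum [Finite ι] (p : ι → unitInterval) {κ : Type*}
    [DecidableEq κ] (s : Finset κ) {A : Set (Set ι)} {C : κ → Set (Set ι)}
    (hdisj : ∀ i ∈ s, ∀ j ∈ s, i ≠ j → Disjoint (C i) (C j))
    (hdisjA : ∀ i ∈ s, Disjoint A (C i)) (hup : ∀ i ∈ s, IsUpperSet (A ∪ C i)) (hA : IsUpperSet A) :
    ∑ i ∈ s, ∑ j ∈ s.erase i, (prodBernoulli p).real (C i) * (prodBernoulli p).real (C j) ≤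
      2 * ((prodBernoulli p).real A * (prodBernoulli p).real (A ∪ ⋃ i ∈ s, C i)ᶜ) := by
  have h := prodBernoulli_strongHarris p s hdisj hdisjA hup hA
  have e : ∑ i ∈ s, ∑ j ∈ s.erase i, (prodBernoulli p).real (C i) * (prodBernoulli p).real (C j) =
      (∑ i ∈ s, (prodBernoulli p).real (C i)) ^ 2 - ∑ i ∈ s, (prodBernoulli p).real (C i) ^ 2 := by
    rw [sq, Finset.sum_mul_sum, ← Finset.sum_sub_distrib]
    refine Finset.sum_congr rfl fun i hi => ?_
    rw [← Finset.mul_sum, ← Finset.mul_sum, Finset.sum_erase_eq_sub hi, mul_sub, sq]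
  rw [e]; exact h

/-- **The case of at least two middle cells**, exactly as printed (`k ≥ 2`): then `A = ⋂ (A ∪ C i)`
is automatically closed upwards, so the hypothesis on `A` can be dropped.
[cite: Gladkov2024StrongFKG, Thm. 2.1] -/
theorem prodBernoulli_strongHarris_of_two_le [Finite ι] (p : ι → unitInterval) {κ : Type*}
    (s : Finset κ) (hs : 2 ≤ s.card) {A : Set (Set ι)} {C : κ → Set (Set ι)}
    (hdisj : ∀ i ∈ s, ∀ j ∈ s, i ≠ j → Disjoint (C i) (C j))
    (hdisjA : ∀ i ∈ s, Disjoint A (C i)) (hup : ∀ i ∈ s, IsUpperSet (A ∪ C i)) :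
    (∑ i ∈ s, (prodBernoulli p).real (C i)) ^ 2 - ∑ i ∈ s, (prodBernoulli p).real (C i) ^ 2 ≤
      2 * ((prodBernoulli p).real A * (prodBernoulli p).real (A ∪ ⋃ i ∈ s, C i)ᶜ) := by
  classical
  -- pick two distinct indices `i ≠ j` in `s`; then `A = (A ∪ C i) ∩ (A ∪ C j)`
  have hs' : 1 < s.card := hs
  obtain ⟨i, hi, j, hj, hij⟩ := Finset.one_lt_card.1 hs'
  have hA : IsUpperSet A := by
    have hAeq : A = (A ∪ C i) ∩ (A ∪ C j) := by
      ext ω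
      simp only [Set.mem_inter_iff, Set.mem_union]
      constructor
      · intro h; exact ⟨Or.inl h, Or.inl h⟩
      · rintro ⟨h1 | h1, h2 | h2⟩
        · exact h1
        · exact h1
        · exact h2
        · exact absurd h2 (Set.disjoint_left.1 (hdisj i hi j hj hij) h1)
    rw [hAeq]; exact (hup i hi).inter (hup j hj)
  exact prodBernoulli_strongHarris p s hdisj hdisjA hup hA

/-- **Sunflower form of Gladkov's strong Harris–Kleitman inequality.**  For `μ = prodBernoulli p`
(`ι` finite) and increasing events `E i` (`i ∈ s`) forming a SUNFLOWER with core `A` — every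
pairwise intersection `E i ∩ E j` (`i ≠ j` in `s`) equals `A`, and `A ⊆ E i` for every `i ∈ s` —
with `A` increasing (automatic when `|s| ≥ 2`):
`(Σ_i μ(E i ∖ A))² − Σ_i μ(E i ∖ A)² ≤ 2 μ(A) μ((A ∪ ⋃_i E i)ᶜ)`.
This is Thm. 2.1 with the petals `C i = E i ∖ A` as middle cells (`A ∪ C i = E i` is closed
upwards; the petals are pairwise disjoint because the pairwise intersections are the core).  It is
the form in which the inequality is applied to sunflowers of up-sets of a finite lattice of
"patterns" (e.g. connection patterns of boundary vertices in percolation: three petals `{a↔b}`,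
`{a↔c}`, `{b↔c}` with core `{a↔b↔c}` give Cor. 4.2 of the paper).
[cite: Gladkov2024StrongFKG, Thm. 2.1 — corollary (sunflower rephrasing)] -/
theorem prodBernoulli_strongHarris_sunflower [Finite ι] (p : ι → unitInterval) {κ : Type*}
    (s : Finset κ) {A : Set (Set ι)} {E : κ → Set (Set ι)} (hE : ∀ i ∈ s, IsUpperSet (E i))
    (hA : IsUpperSet A) (hAE : ∀ i ∈ s, A ⊆ E i)
    (hcore : ∀ i ∈ s, ∀ j ∈ s, i ≠ j → E i ∩ E j ⊆ A) :
    (∑ i ∈ s, (prodBernoulli p).real (E i \ A)) ^ 2 - ∑ i ∈ s, (prodBernoulli p).real (E i \ A) ^ 2 ≤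
      2 * ((prodBernoulli p).real A * (prodBernoulli p).real (A ∪ ⋃ i ∈ s, E i)ᶜ) := by
  classical
  -- petals `C i = E i ∖ A`
  have hdisj : ∀ i ∈ s, ∀ j ∈ s, i ≠ j → Disjoint (E i \ A) (E j \ A) := by
    intro i hi j hj hij
    exact Set.disjoint_left.2 fun ω h1 h2 => h1.2 (hcore i hi j hj hij ⟨h1.1, h2.1⟩)
  have hdisjA : ∀ i ∈ s, Disjoint A (E i \ A) :=
    fun i _ => Set.disjoint_left.2 fun ω hω h => h.2 hω
  have hAC : ∀ i ∈ s, A ∪ (E i \ A) = E i := fun i hi => by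
    rw [Set.union_sdiff_cancel (hAE i hi)]
  have hup : ∀ i ∈ s, IsUpperSet (A ∪ (E i \ A)) := fun i hi => by
    rw [hAC i hi]; exact hE i hi
  have key := prodBernoulli_strongHarris p s hdisj hdisjA hup hA
  -- the bottom cell: `A ∪ ⋃ (E i ∖ A) = A ∪ ⋃ E i`
  have hU : (A ∪ ⋃ i ∈ s, (E i \ A)) = A ∪ ⋃ i ∈ s, E i := by
    ext ω
    simp only [Set.mem_union, Set.mem_iUnion, Set.mem_sdiff, exists_prop]
    constructor
    · rintro (h | ⟨i, hi, h, -⟩)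
      · exact Or.inl h
      · exact Or.inr ⟨i, hi, h⟩
    · rintro (h | ⟨i, hi, h⟩)
      · exact Or.inl h
      · by_cases hω : ω ∈ A
        · exact Or.inl hω
        · exact Or.inr ⟨i, hi, h, hω⟩
  rw [hU] at key
  exact key

/-- **Three-petal sunflower form** (the shape used most often: three increasing events with a common
pairwise intersection `A`), with the second symmetric polynomial written out:
`μ(E₁∖A) μ(E₂∖A) + μ(E₁∖A) μ(E₃∖A) + μ(E₂∖A) μ(E₃∖A) ≤ μ(A) μ((E₁ ∪ E₂ ∪ E₃)ᶜ)`.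
[cite: Gladkov2024StrongFKG, Thm. 2.1 — corollary (k = 3)] -/
theorem prodBernoulli_strongHarris_sunflower_three [Finite ι] (p : ι → unitInterval)
    {A E₁ E₂ E₃ : Set (Set ι)} (h₁ : IsUpperSet E₁) (h₂ : IsUpperSet E₂) (h₃ : IsUpperSet E₃)
    (h12 : E₁ ∩ E₂ = A) (h13 : E₁ ∩ E₃ = A) (h23 : E₂ ∩ E₃ = A) :
    (prodBernoulli p).real (E₁ \ A) * (prodBernoulli p).real (E₂ \ A) +
        (prodBernoulli p).real (E₁ \ A) * (prodBernoulli p).real (E₃ \ A) +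
        (prodBernoulli p).real (E₂ \ A) * (prodBernoulli p).real (E₃ \ A) ≤
      (prodBernoulli p).real A * (prodBernoulli p).real (E₁ ∪ E₂ ∪ E₃)ᶜ := by
  classical
  have hA : IsUpperSet A := by rw [← h12]; exact h₁.inter h₂
  let E : Fin 3 → Set (Set ι) := ![E₁, E₂, E₃]
  have e0 : E 0 = E₁ := rfl
  have e1 : E 1 = E₂ := rfl
  have e2 : E 2 = E₃ := rfl
  have hE : ∀ i ∈ (Finset.univ : Finset (Fin 3)), IsUpperSet (E i) := by
    intro i _; fin_cases i
    · exact h₁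
    · exact h₂
    · exact h₃
  have hAE : ∀ i ∈ (Finset.univ : Finset (Fin 3)), A ⊆ E i := by
    intro i _; fin_cases i
    · change A ⊆ E₁; rw [← h12]; exact Set.inter_subset_left
    · change A ⊆ E₂; rw [← h12]; exact Set.inter_subset_right
    · change A ⊆ E₃; rw [← h13]; exact Set.inter_subset_right
  have hcore : ∀ i ∈ (Finset.univ : Finset (Fin 3)), ∀ j ∈ (Finset.univ : Finset (Fin 3)),
      i ≠ j → E i ∩ E j ⊆ A := by
    intro i _ j _ hij
    fin_cases i <;> fin_cases j
    all_goals first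
      | exact (hij rfl).elim
      | (change E₁ ∩ E₂ ⊆ A; exact h12.le)
      | (change E₂ ∩ E₁ ⊆ A; rw [Set.inter_comm]; exact h12.le)
      | (change E₁ ∩ E₃ ⊆ A; exact h13.le)
      | (change E₃ ∩ E₁ ⊆ A; rw [Set.inter_comm]; exact h13.le)
      | (change E₂ ∩ E₃ ⊆ A; exact h23.le)
      | (change E₃ ∩ E₂ ⊆ A; rw [Set.inter_comm]; exact h23.le)
  have key := prodBernoulli_strongHarris_sunflower p (Finset.univ : Finset (Fin 3)) hE hA hAE hcore
  have hU : (A ∪ ⋃ i ∈ (Finset.univ : Finset (Fin 3)), E i) = E₁ ∪ E₂ ∪ E₃ := by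
    ext ω
    simp only [Finset.mem_univ, Set.iUnion_true, Set.mem_union, Set.mem_iUnion]
    constructor
    · rintro (h | ⟨i, hi⟩)
      · exact Or.inl (Or.inl ((h12.symm.le h : ω ∈ E₁ ∩ E₂).1))
      · fin_cases i
        · exact Or.inl (Or.inl hi)
        · exact Or.inl (Or.inr hi)
        · exact Or.inr hi
    · rintro ((h | h) | h)
      · exact Or.inr ⟨0, h⟩
      · exact Or.inr ⟨1, h⟩
      · exact Or.inr ⟨2, h⟩
  rw [hU] at key
  simp only [Fin.sum_univ_three, e0, e1, e2] at key
  nlinarith [key]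

end Literature.Probability.LatticeModels
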